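import Literature.NumberTheory.GaloisCohomology.ArchimedeanInvariantMap
import Literature.AnabelianGeometry.AbsoluteAnabelian.LocalBrauerGroupQmodZ
import Literature.NumberTheory.GaloisRepresentations.HomDualReadoutLocal
import HarnessLib

/-!
# The Ш²-cochain bridge, local currency dictionary: `hPTc`'s `ℤ/n`-valued local terms `inv_v [c]` for `μₙ(K̄)|_{Γ_v}`-valued
# local `2`-cocycles versus the Brauer invariant `inv_{K_v} ∈ ℚ/ℤ` of their push-forward to `K̄_vˣ` (step (D) of SHA2-BRIDGE-w3g7)

Route `SemiOrdinaryEisensteinDescent` (BSD), Kolyvagin column, Cassels–Tate lane: print item `CasselsTateLevelInputsFact`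
(stmt-BirchSwinnertonDyer-20191), binder `hbridge` of `ShaTwoCochainTheta.casselsTate_levelInputs_of_readout_vanishing` (p638776).
The two sides of the bridge speak different currencies at a place `v`:
* `hPTc` / `PTChoice.localTerm` (and S1′ `…PairChoiceIndependence`): local `2`-cocycles valued in `μₙ(K̄)` RESTRICTED to
  `Γ_{K_v}` (`(mu K n).toLocal v`), read by THE family `LocalInvariants.canonical K n v : H²(Γ_{K_v}, μₙ(K̄)|) →+ ℤ/n`
  (`localInvariantMap` at finite `v`, `archimedeanInvariantMap` at infinite `w`);
* the bridge (`…BridgePackage`, conjunct (6)) and step S3: `K̄_vˣ`-valued local `2`-cocycles (`units K_v`), read by the Brauer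
  invariant `Prop121vii.brauerInvariantEquiv K_v : H²(Γ_{K_v}, K̄_vˣ) ≃+ ℚ/ℤ`; the passage is the push-forward along
  `j_v = ι_v ∘ κ = κ_v ∘ (μₙ(K̄) ⥲ μₙ(K̄_v))` (`unitsTransferAddHom_kummerInclAddHom`: `ι_v = unitsTransfer K K_v`, `κ = kummerι`).

* **`brauerInvariantEquiv_cohomologyMap_muLocalIso_kummer`** — at a finite place: `inv_{K_v} ((κ_v ∘ μ-iso)_* x) = (inv_v x)/n`
  in `ℚ/ℤ` (`zmodToQmodZ`), for every `x ∈ H²(Γ_{K_v}, μₙ(K̄)|)`.  [`localInvariantMap_apply` + `brauerInvariantEquiv_kummer`]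
* **`twoCocycleClass_push_eq_cohomologyMap`** — the class of any `K̄_vˣ`-valued `2`-cocycle that is POINTWISE `ι_v (κ (z(σ,τ)))`
  is `(μ-iso ≫ κ_v)_* [z]` (so the first bullet applies to the bridge's pointwise identities).
* At an infinite place and ODD `n` every local term vanishes: this is ALREADY the tree's
  `LocalInvariants.canonical_inl_eq_zero_of_odd` (`PoitouTateOddLevelRealPlaces.lean`) — import it, nothing is restated here.

Width seat `bsd-wall-soed-p2-w3` g7; `--supports stmt-BirchSwinnertonDyer-20480`, helper.  THEOREMS ONLY; no case of BSD,
Poitou–Tate or Cassels–Tate is proved here.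

## References
* [MilneADT2006] J. S. Milne, *Arithmetic Duality Theorems*, 2nd ed. (2006), I §1 (`inv_v`), Ex. 1.6 (b), (c), Thm. 4.10.
* [SerreLocalFields1979] J.-P. Serre, *Local Fields* (1979), XIII §3 Cor. 3, XIV §1 Prop. 3.
* [CasselsFrohlichANT1967] J. W. S. Cassels, A. Fröhlich (eds.), *Algebraic Number Theory* (1967), Ch. VI §1.1, Ch. VII §11.2 (bis).
-/

noncomputable section

-- `Summit.<P>.<Sub>` repeats `BirchSwinnertonDyer` by the tree's layout convention (D-0017)
set_option linter.dupNamespace false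
set_option autoImplicit false

namespace Summit.BirchSwinnertonDyer.BirchSwinnertonDyer.Theorems.ShaTwoCochain

open CategoryTheory NumberField IsDedekindDomain
open Literature.NumberTheory.GaloisRepresentations Literature.NumberTheory.GaloisCohomology
open Literature.NumberTheory.GaloisRepresentations.DiscreteGaloisModule (units UnitsCarrier mu MuCarrier)
open Literature.NumberTheory.GaloisRepresentations.HomDual (unitsTransferAddHom unitsTransferAddHom_kummerInclAddHom)
open Literature.AnabelianGeometry.AbsoluteAnabelian (Prop121vii.brauerInvariantEquiv Prop121vii.invLevel Prop121vii.zmodToQmodZ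
  Prop121vii.zmodToQmodZ_apply Prop121vii.brauerInvariantEquiv_kummer)
open scoped NumberField

variable {K : Type} [Field K] [NumberField K] {n : ℕ} [NeZero n]

/-! ## §1 Finite places: `inv_{K_v} ∘ (κ_v ∘ μ-iso)_* = inv_v / n` -/

/-- **The finite-place dictionary**: for `x ∈ H²(Γ_{K_v}, μₙ(K̄)|)`,
`inv_{K_v} ((muLocalIso ≫ κ_v)_* x) = zmodToQmodZ n (canonical K n v x)` (`= (inv_v x)/n ∈ ℚ/ℤ`).
[cite: MilneADT2006, I §1, Ex. 1.6 (b)][cite: SerreLocalFields1979, XIII §3 Cor. 3] -/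
theorem brauerInvariantEquiv_cohomologyMap_muLocalIso_kummer (v : HeightOneSpectrum (𝓞 K))
    (x : galoisCohomology ((mu K n).toLocal (Sum.inr v)) 2) :
    haveI : CharZero (v.adicCompletion K) := charZero_adicCompletion v
    Prop121vii.brauerInvariantEquiv (v.adicCompletion K)
        (cohomologyMap ((muLocalIso v n).hom ≫ kummerι (v.adicCompletion K) n) 2 x) =
      Prop121vii.zmodToQmodZ n (LocalInvariants.canonical K n (Sum.inr v) x) := by
  haveI : CharZero (v.adicCompletion K) := charZero_adicCompletion v
  rw [cohomologyMap_comp_apply, LocalInvariants.canonical_inr, localInvariantMap_apply, Prop121vii.zmodToQmodZ_apply]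
  exact Prop121vii.brauerInvariantEquiv_kummer (K := v.adicCompletion K) ⟨n, NeZero.pos n⟩ (cohomologyMap (muLocalIso v n).hom 2 x)

/-- **Pointwise recognition of the push-forward**: a `K̄_vˣ`-valued `2`-cocycle `z'` of `Γ_{K_v}` with
`z'(σ,τ) = ι_v (κ (z(σ,τ)))` for a `μₙ(K̄)|`-valued `2`-cocycle `z` has class `(muLocalIso ≫ κ_v)_* [z]`
(`ι_v ∘ κ = κ_v ∘ muTransfer`). [cite: MilneADT2006, I §0, I §1] -/
theorem twoCocycleClass_push_eq_cohomologyMap (v : HeightOneSpectrum (𝓞 K))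
    (z : contTwoCocycles ((mu K n).toLocal (Sum.inr v)).toTopRep)
    (z' : contTwoCocycles (units (v.adicCompletion K)).toTopRep)
    (hz' : ∀ σ τ : Field.absoluteGaloisGroup (v.adicCompletion K),
      z'.1 (σ, τ) = unitsTransferAddHom K (v.adicCompletion K) (kummerInclAddHom K n (z.1 (σ, τ)))) :
    haveI := absoluteGaloisGroup_compactSpace (v.adicCompletion K)
    twoCocycleClass _ z' = cohomologyMap ((muLocalIso v n).hom ≫ kummerι (v.adicCompletion K) n) 2 (twoCocycleClass _ z) := by
  haveI := absoluteGaloisGroup_compactSpace (v.adicCompletion K)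
  rw [cohomologyMap_twoCocycleClass]
  congr 1
  refine Subtype.ext (ContinuousMap.ext fun q => ?_)
  obtain ⟨σ, τ⟩ := q
  rw [hz', contTwoCocycles.pullback_apply, unitsTransferAddHom_kummerInclAddHom]
  rfl

end Summit.BirchSwinnertonDyer.BirchSwinnertonDyer.Theorems.ShaTwoCochain

end
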